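/-
Copyright: the b2b-balaban T⁴-continuum CRUX team, row NE7b leaf lineage `t4-ne7b-formalise-leaf-05` (gen 142). Project licence.
-/
import Summits.QuantumFields.BalabanUV.T4Continuum.Spine.NE7b.HessianLocality

/-!
# COORDINATE READINGS: the glue between `…HessianLocality` §4 (a local term read through a linear map, Hessian letter in the
# seminorm `‖π v‖`) and §1–§3 (bounded-overlap double count over supports `S_p ⊆ Fin n`) — `‖π_S v‖² = Σ_{i ∈ S} v_i²`, the overlap
# inequality `Σ_p ‖π_{S_p} v‖² ≤ d·‖v‖²` from the card bound, and the road's Hessian letter ON a window for `P = Σ_p F_p ∘ π_{S_p}` from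
# per-factor letters on the SMALL factors (row NE7b, node U5c; residual (R2′) family (2); OWNER word W-ne7bp1-g108-2)

Cell `pub-balaban`, sub-cell `t4`, spine estimate NE7b (`T4WeightBudget.RelWeightBound`; the cell's OWN estimate — NOT PRINTED in
[Bałaban 1983–89], NOT PROVED).  Crux-route work under `Spine/NE7b/` by a row leaf on the OWNER's per-plaquette road
(`…HessianLocality`, `…ConvexWindowLocalSocket`), filed on the OWNER's word W-ne7bp1-g108-2 (journal [NE7bP1-G108-CLOSE]); NOTHING of
Bałaban's is named or asserted; no `T4Continuum/Support` leaf typed; no `def`; zero `sorry`.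

WHY.  `…HessianLocality` proves that Hessian-smallness is local in two vocabularies: §1–§3 with supports `S_p ⊆ Fin n` and per-term
letters in the restricted coordinate sum `Σ_{i ∈ S_p} v_i²` (overlap counted by `#{p : i ∈ S_p} ≤ d`), and §4–§5 with local terms
`F_p ∘ π_p` read through continuous linear maps and per-term letters in the seminorm `‖π_p v‖²` (overlap asked as the abstract inequality
`Σ_p h_p‖π_p v‖² ≤ H‖v‖²`, which is also the `hov` letter of `…ConvexWindowLocalSocket`).  Print's plaquette terms are of the second
kind with `π_p` a COORDINATE READING of the bond variables on the plaquette — a continuous linear map `π : E → EuclideanSpace ℝ S` with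
`(π v)_i = v_i` for `i ∈ S`.  For such maps the two vocabularies coincide: `‖π v‖² = Σ_{i ∈ S} v_i²`, so the card bound on the supports
DISCHARGES the abstract overlap inequality with `H = d·max_p h_p`, and per-factor letters on the small factors give the road's letter ON the
window with `h = c·d`.  This file is that glue, stated for ANY coordinate readings (hypothesis `hπ`; a witness exists, §1), so that the
(A3) instance owes, per plaquette, only a Hessian letter for `F_p` on its own few coordinates and the combinatorial count `d`
(`= 2(𝖽 − 1) = 6` plaquettes per bond in four dimensions).

WHAT IS PROVED ([folklore]; `…HessianLocality` BY NAME):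
* §1 `norm_sq_eq_sum_sq_of_coordReading` (`‖π v‖² = Σ_{i ∈ S} v_i²` for a coordinate reading `π` of `S`), `exists_coordReading`
  (a coordinate reading of every `S` exists — the restriction map), **`sum_norm_sq_coordReading_le`** (every coordinate in at most `d`
  supports ⟹ `Σ_p ‖π_p v‖² ≤ d·‖v‖²` — the overlap letter `hov` of `…ConvexWindowLocalSocket` for coordinate readings),
  `sum_mul_norm_sq_coordReading_le` (weighted: `h_p ≤ h_max`, `0 ≤ h_max` ⟹ `Σ_p h_p‖π_p v‖² ≤ (h_max·d)·‖v‖²` — the `hov` letter of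
  `…HessianLocality.hessianOn_lower_of_localTerms`).
* §2 **`hessianOn_lower_of_coordLocalTerms`**: `F_p ∈ C²` on `EuclideanSpace ℝ (S p)`, `−c‖w‖² ≤ D²F_p(π_p x)[w,w]` for `x ∈ K` and all
  `w`, every coordinate in at most `d` supports, `c ≥ 0` ⟹ `∀ x ∈ K, ∀ v, −(c·d)‖v‖² ≤ D²(Σ_p F_p ∘ π_p)(x)[v,v]` — the `hH` letter of
  `…ConvexWindowSuppliers.firstOrderOn_quadratic_add_of_hessianOn` with `h = c·d`; **`abs_hessianOn_le_of_coordLocalTerms`**: the two-sided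
  form from operator-norm letters `‖D²F_p(π_p x)‖ ≤ c` ⟹ `|D²(Σ_p F_p ∘ π_p)(x)[v,v]| ≤ c·d·‖v‖²`; `contDiff_two_coordLocalTerms`.

* §3 (appended gen 146, OWNER word W-ne7bp1-g109-3): **`sum_norm_sq_isometry_coordReading_le`** (the overlap letter survives
  post-composition with ANY linear isometries `e_p`) and **`sum_norm_sq_finReading_le`** (the `Fin (S p).card`-indexed reading
  `(re-indexing isometry) ∘L π_p` — the `hov` letter of `…ConvexWindowLocalSocket` in its own `Fin (m p)` currency, `m p := (S p).card`).

NOT HERE (honest): print's plaquette functions `F_p`, their Hessian ∕ third-derivative letters and the numbers by value ((A1c)∕(A3)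
readings; idea-1 T-71 ∕ refuter F463: `c_p·M₀ε_k`-class per plaquette, `d = 6`); anything of Bałaban's.  NE7b NOT PRINTED ∕ NOT PROVED;
spine PROVED 0∕9; rung (B)+1 on a FINITE torus — NOT infinite volume, NOT the mass gap, NOT Clay.
HONEST DEPENDENCY: continuum YM on T⁴ ⇐ BetaPertH ∧ nine spine estimates (0/9 proved); BetaPertH ⇐ (D1) ∧ (D4) ∧ CAP+tail; G-an2-4
gates asym, D1 and NE2/3/4.
-/

set_option autoImplicit false

noncomputable section

open Finset
open Summit.QuantumFields.BalabanUV.T4Continuum.NE7b.HessianLocality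

namespace Summit.QuantumFields.BalabanUV.T4Continuum.NE7b.HessianLocalityCoord

variable {n : ℕ}

/-! ## §1 Coordinate readings: the seminorm is the restricted coordinate sum; existence; the overlap letter from the card bound -/

/-- **THE SEMINORM OF A COORDINATE READING IS THE RESTRICTED COORDINATE SUM**: if `π : E →L[ℝ] EuclideanSpace ℝ S` reads the
coordinates of `S` (`(π v)_i = v_i` for `i ∈ S`), then `‖π v‖² = Σ_{i ∈ S} v_i²`. [folklore] -/
theorem norm_sq_eq_sum_sq_of_coordReading (S : Finset (Fin n)) (π : EuclideanSpace ℝ (Fin n) →L[ℝ] EuclideanSpace ℝ S)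
    (hπ : ∀ (v : EuclideanSpace ℝ (Fin n)) (i : S), π v i = v i) (v : EuclideanSpace ℝ (Fin n)) :
    ‖π v‖ ^ 2 = ∑ i ∈ S, v i ^ 2 := by
  rw [EuclideanSpace.norm_eq, Real.sq_sqrt (Finset.sum_nonneg fun i _ => sq_nonneg _)]
  rw [← Finset.sum_coe_sort S (fun i => v i ^ 2)]
  refine Finset.sum_congr rfl fun i _ => ?_
  rw [Real.norm_eq_abs, sq_abs, hπ v i]

/-- **A COORDINATE READING OF EVERY SUPPORT EXISTS** (the restriction map `v ↦ (v_i)_{i ∈ S}` as a continuous linear map into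
`EuclideanSpace ℝ S`). [folklore] -/
theorem exists_coordReading (S : Finset (Fin n)) :
    ∃ π : EuclideanSpace ℝ (Fin n) →L[ℝ] EuclideanSpace ℝ S, ∀ (v : EuclideanSpace ℝ (Fin n)) (i : S), π v i = v i :=
  ⟨(EuclideanSpace.equiv (↥S) ℝ).symm.toContinuousLinearMap.comp
      (ContinuousLinearMap.pi fun i : S => EuclideanSpace.proj (i : Fin n)),
    fun _ _ => rfl⟩

/-- **THE OVERLAP LETTER FOR COORDINATE READINGS**: supports `S_p` with every coordinate in at most `d` of them and coordinate readings
`π_p` of `S_p` ⟹ `Σ_p ‖π_p v‖² ≤ d·‖v‖²` for every `v` — the `hov` letter of `…ConvexWindowLocalSocket` (with its real overlap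
constant `d`) discharged from the combinatorial count by `…HessianLocality.sum_sum_mem_le_of_boundedOverlap`. [folklore] -/
theorem sum_norm_sq_coordReading_le {𝔓 : Type*} [Fintype 𝔓] (S : 𝔓 → Finset (Fin n))
    (π : (p : 𝔓) → (EuclideanSpace ℝ (Fin n) →L[ℝ] EuclideanSpace ℝ (S p)))
    (hπ : ∀ p (v : EuclideanSpace ℝ (Fin n)) (i : S p), π p v i = v i)
    {d : ℕ} (hd : ∀ i, (Finset.univ.filter fun p => i ∈ S p).card ≤ d) (v : EuclideanSpace ℝ (Fin n)) :
    ∑ p, ‖π p v‖ ^ 2 ≤ (d : ℝ) * ‖v‖ ^ 2 := by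
  simp_rw [norm_sq_eq_sum_sq_of_coordReading (S _) (π _) (hπ _) v]
  rw [norm_sq_eq_sum_sq]
  exact sum_sum_mem_le_of_boundedOverlap S hd fun i => sq_nonneg _

/-- **THE WEIGHTED OVERLAP LETTER FOR COORDINATE READINGS**: with weights `h_p ≤ h_max`, `h_max ≥ 0`, and every coordinate in at most `d` supports,
`Σ_p h_p·‖π_p v‖² ≤ (h_max·d)·‖v‖²` — the `hov` letter of `…HessianLocality.hessianOn_lower_of_localTerms` for coordinate readings.
[folklore] -/
theorem sum_mul_norm_sq_coordReading_le {𝔓 : Type*} [Fintype 𝔓] (S : 𝔓 → Finset (Fin n))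
    (π : (p : 𝔓) → (EuclideanSpace ℝ (Fin n) →L[ℝ] EuclideanSpace ℝ (S p)))
    (hπ : ∀ p (v : EuclideanSpace ℝ (Fin n)) (i : S p), π p v i = v i)
    {d : ℕ} (hd : ∀ i, (Finset.univ.filter fun p => i ∈ S p).card ≤ d) (hterm : 𝔓 → ℝ) {hmax : ℝ}
    (hmax0 : 0 ≤ hmax) (hle : ∀ p, hterm p ≤ hmax) (v : EuclideanSpace ℝ (Fin n)) :
    ∑ p, hterm p * ‖π p v‖ ^ 2 ≤ hmax * d * ‖v‖ ^ 2 :=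
  calc ∑ p, hterm p * ‖π p v‖ ^ 2 ≤ ∑ p, hmax * ‖π p v‖ ^ 2 :=
        Finset.sum_le_sum fun p _ => mul_le_mul_of_nonneg_right (hle p) (sq_nonneg _)
    _ = hmax * ∑ p, ‖π p v‖ ^ 2 := by rw [Finset.mul_sum]
    _ ≤ hmax * ((d : ℝ) * ‖v‖ ^ 2) := mul_le_mul_of_nonneg_left (sum_norm_sq_coordReading_le S π hπ hd v) hmax0
    _ = hmax * d * ‖v‖ ^ 2 := by ring

/-! ## §2 The road's Hessian letter ON a window for `Σ_p F_p ∘ π_p` from per-factor letters on the small factors -/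

section CoordLocalTerms

variable {𝔓 : Type*} [Fintype 𝔓]

/-- **THE HESSIAN LETTER ON THE WINDOW FROM PER-FACTOR LETTERS, COORDINATE READINGS** (§4 of `…HessianLocality` fed into its §3):
local terms `P_p = F_p ∘ π_p` with `π_p` a coordinate reading of the support `S_p`, `F_p ∈ C²` on `EuclideanSpace ℝ (S p)` with the letter
`−c‖w‖² ≤ D²F_p(π_p x)[w,w]` for `x ∈ K` and every `w`, every coordinate in at most `d` supports, `c ≥ 0` ⟹
`∀ x ∈ K, ∀ v, −(c·d)·‖v‖² ≤ D²(Σ_p F_p ∘ π_p)(x)[v,v]` — the `hH` letter of `…ConvexWindowSuppliers.firstOrderOn_quadratic_add_of_hessianOn`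
with `h = c·d`. [folklore] -/
theorem hessianOn_lower_of_coordLocalTerms (S : 𝔓 → Finset (Fin n))
    (π : (p : 𝔓) → (EuclideanSpace ℝ (Fin n) →L[ℝ] EuclideanSpace ℝ (S p)))
    (hπ : ∀ p (v : EuclideanSpace ℝ (Fin n)) (i : S p), π p v i = v i)
    (F : (p : 𝔓) → EuclideanSpace ℝ (S p) → ℝ) (hF : ∀ p, ContDiff ℝ 2 (F p))
    {d : ℕ} (hd : ∀ i, (Finset.univ.filter fun p => i ∈ S p).card ≤ d) {c : ℝ} (hc : 0 ≤ c)
    (K : Set (EuclideanSpace ℝ (Fin n)))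
    (hH : ∀ p, ∀ x ∈ K, ∀ w : EuclideanSpace ℝ (S p), -c * ‖w‖ ^ 2 ≤ iteratedFDeriv ℝ 2 (F p) (π p x) ![w, w]) :
    ∀ x ∈ K, ∀ v : EuclideanSpace ℝ (Fin n),
      -(c * d) * ‖v‖ ^ 2 ≤ iteratedFDeriv ℝ 2 (fun z => ∑ p, F p (π p z)) x ![v, v] :=
  hessianOn_lower_of_boundedOverlap (fun p z => F p (π p z)) (fun p => (hF p).comp (π p).contDiff) S hd hc K
    fun p x hx v => by
      rw [← norm_sq_eq_sum_sq_of_coordReading (S p) (π p) (hπ p) v]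
      exact hessianOn_comp_clm_lower (π p) (hF p) K (hH p) x hx v

/-- **THE TWO-SIDED LETTER FROM OPERATOR-NORM LETTERS ON THE SMALL FACTORS**: `‖D²F_p(π_p x)‖ ≤ c` for `x ∈ K` (coordinate readings
`π_p` of supports with overlap `≤ d`, `c ≥ 0`) ⟹ `∀ x ∈ K, ∀ v, |D²(Σ_p F_p ∘ π_p)(x)[v,v]| ≤ c·d·‖v‖²`. [folklore] -/
theorem abs_hessianOn_le_of_coordLocalTerms (S : 𝔓 → Finset (Fin n))
    (π : (p : 𝔓) → (EuclideanSpace ℝ (Fin n) →L[ℝ] EuclideanSpace ℝ (S p)))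
    (hπ : ∀ p (v : EuclideanSpace ℝ (Fin n)) (i : S p), π p v i = v i)
    (F : (p : 𝔓) → EuclideanSpace ℝ (S p) → ℝ) (hF : ∀ p, ContDiff ℝ 2 (F p))
    {d : ℕ} (hd : ∀ i, (Finset.univ.filter fun p => i ∈ S p).card ≤ d) {c : ℝ} (hc : 0 ≤ c)
    (K : Set (EuclideanSpace ℝ (Fin n))) (hH : ∀ p, ∀ x ∈ K, ‖iteratedFDeriv ℝ 2 (F p) (π p x)‖ ≤ c) :
    ∀ x ∈ K, ∀ v : EuclideanSpace ℝ (Fin n),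
      |iteratedFDeriv ℝ 2 (fun z => ∑ p, F p (π p z)) x ![v, v]| ≤ c * d * ‖v‖ ^ 2 :=
  fun x hx v => abs_hessian_le_of_boundedOverlap (fun p z => F p (π p z)) (fun p => (hF p).comp (π p).contDiff) S hd hc x v
    fun p => by
      rw [← norm_sq_eq_sum_sq_of_coordReading (S p) (π p) (hπ p) v]
      exact abs_hessianOn_comp_clm_le (π p) (hF p) K (hH p) x hx v

/-- The sum of local terms through coordinate readings is `C²` (the regularity letter of the road). [folklore] -/
theorem contDiff_two_coordLocalTerms (S : 𝔓 → Finset (Fin n))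
    (π : (p : 𝔓) → (EuclideanSpace ℝ (Fin n) →L[ℝ] EuclideanSpace ℝ (S p)))
    (F : (p : 𝔓) → EuclideanSpace ℝ (S p) → ℝ) (hF : ∀ p, ContDiff ℝ 2 (F p)) :
    ContDiff ℝ 2 fun z : EuclideanSpace ℝ (Fin n) => ∑ p, F p (π p z) :=
  contDiff_two_localTerms π F hF

end CoordLocalTerms

/-! ## §3 (appended gen 146, OWNER word W-ne7bp1-g109-3): the overlap letter after an isometric re-indexing — the
`Fin (m p)`-indexed currency of `…ConvexWindowLocalSocket`'s `hov` -/

section Reindex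

variable {𝔓 : Type*} [Fintype 𝔓]

/-- **THE OVERLAP LETTER SURVIVES ANY ISOMETRIC RE-READING**: coordinate readings `π_p` of supports `S_p` (every coordinate in at most `d`
supports) post-composed with linear isometries `e_p : EuclideanSpace ℝ (S p) →ₗᵢ G_p` ⟹ `Σ_p ‖e_p (π_p v)‖² ≤ d·‖v‖²`. [folklore] -/
theorem sum_norm_sq_isometry_coordReading_le (S : 𝔓 → Finset (Fin n))
    (π : (p : 𝔓) → (EuclideanSpace ℝ (Fin n) →L[ℝ] EuclideanSpace ℝ (S p)))
    (hπ : ∀ p (v : EuclideanSpace ℝ (Fin n)) (i : S p), π p v i = v i)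
    {G : 𝔓 → Type*} [∀ p, NormedAddCommGroup (G p)] [∀ p, NormedSpace ℝ (G p)]
    (e : (p : 𝔓) → (EuclideanSpace ℝ (S p) →ₗᵢ[ℝ] G p))
    {d : ℕ} (hd : ∀ i, (Finset.univ.filter fun p => i ∈ S p).card ≤ d) (v : EuclideanSpace ℝ (Fin n)) :
    ∑ p, ‖e p (π p v)‖ ^ 2 ≤ (d : ℝ) * ‖v‖ ^ 2 := by
  simp_rw [LinearIsometry.norm_map]
  exact sum_norm_sq_coordReading_le S π hπ hd v

/-- **THE `Fin (m p)`-INDEXED READING** — the shape of `…ConvexWindowLocalSocket`'s `hov` (`pr p : E →L[ℝ] EuclideanSpace ℝ (Fin (m p))`):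
with `m p := (S p).card` and `pr p := (LinearIsometryEquiv.piLpCongrLeft 2 ℝ ℝ (S p).equivFin) ∘L π_p`, every coordinate in at most `d`
supports ⟹ `Σ_p ‖pr p v‖² ≤ d·‖v‖²`. [folklore] -/
theorem sum_norm_sq_finReading_le (S : 𝔓 → Finset (Fin n))
    (π : (p : 𝔓) → (EuclideanSpace ℝ (Fin n) →L[ℝ] EuclideanSpace ℝ (S p)))
    (hπ : ∀ p (v : EuclideanSpace ℝ (Fin n)) (i : S p), π p v i = v i)
    {d : ℕ} (hd : ∀ i, (Finset.univ.filter fun p => i ∈ S p).card ≤ d) (v : EuclideanSpace ℝ (Fin n)) :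
    ∑ p, ‖((LinearIsometryEquiv.piLpCongrLeft 2 ℝ ℝ (S p).equivFin).toContinuousLinearEquiv.toContinuousLinearMap.comp (π p)) v‖ ^ 2
      ≤ (d : ℝ) * ‖v‖ ^ 2 := by
  have h := sum_norm_sq_isometry_coordReading_le S π hπ (G := fun p => EuclideanSpace ℝ (Fin (S p).card))
    (fun p => (LinearIsometryEquiv.piLpCongrLeft 2 ℝ ℝ (S p).equivFin).toLinearIsometry) hd v
  simpa using h

/-- Non-vacuity toy (`n = 2`, one support `univ` read by a coordinate reading from `exists_coordReading`, `d = 1`): the hypotheses of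
`sum_norm_sq_finReading_le` are jointly inhabited. -/
example : ∃ (S : Unit → Finset (Fin 2)) (π : (p : Unit) → (EuclideanSpace ℝ (Fin 2) →L[ℝ] EuclideanSpace ℝ (S p))),
    (∀ p (v : EuclideanSpace ℝ (Fin 2)) (i : S p), π p v i = v i) ∧ (∀ i, (Finset.univ.filter fun p => i ∈ S p).card ≤ 1) := by
  obtain ⟨π, hπ⟩ := exists_coordReading (n := 2) Finset.univ
  exact ⟨fun _ => Finset.univ, fun _ => π, fun _ => hπ, fun i => by simp⟩

end Reindex

end Summit.QuantumFields.BalabanUV.T4Continuum.NE7b.HessianLocalityCoord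

end
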